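import Summits.CriticalPhenomena.PercolationContinuityZ3.Theorems.PercNearOneGluingNoHeavyLowerTailIncStarTwoCutFXCertKernel
import Summits.CriticalPhenomena.PercolationContinuityZ3.Theorems.PercNearOneGluingNoHeavyLowerTailCubicFourPointL1CertSemantics
import HarnessLib

/-!
# MODE B, XVIII: semantic layer of the (FX)/(FY) certificate kernel — what the 19-variable expressions denote

Support file for the Sahi programme (`--supports stmt-CriticalPhenomena-4575`, prover prim-sahi-p2 gen 28).  No sorries, no named facts,
no `native_decide`.  Companion of `…CubicFourPointL1CertSemantics` for the kernel `…IncStarTwoCutFXCertKernel`: for a valuation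
`x : ℕ → ℝ` of the 19 variables (`0..14` the far cells, `15..18` the near class variables `q0, qX, qY, qW`) and the context `ctx19 x`,
`maskE m ↦ msum m x`, `e3E A B C ↦ e3val A B C x`, `cqE ↦ cqVal x`, `frowE r ↦ frowVal r x`, `monoE l ↦ monoVal l x`, `fcertE bs ↦ fcertVal bs x`,
`ftargetE pos neg ↦ polyVal pos x − polyVal neg x`; hence (`fcertVal_nonneg`) the certificate denotes a nonnegative number as soon as all 19
variables are nonnegative and every row value is nonnegative, and (`ftarget_eq_fcert`) the checked identity `fcheckN` transports to `ℝ`.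
-/

namespace Summit.CriticalPhenomena.PercolationContinuityZ3.Theorems

namespace IncStarTwoCut.FXCert

open Lean.Grind.CommRing FourPointCert

/-! ### The 19-variable context -/

/-- The valuation of the 19 variables as a kernel-friendly random-access array. [this work] -/
noncomputable def ctx19 (x : ℕ → ℝ) : Context ℝ :=
  .branch 8
    (.branch 4 (.branch 2 (.branch 1 (.leaf (x 0)) (.leaf (x 1))) (.branch 3 (.leaf (x 2)) (.leaf (x 3))))
      (.branch 6 (.branch 5 (.leaf (x 4)) (.leaf (x 5))) (.branch 7 (.leaf (x 6)) (.leaf (x 7)))))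
    (.branch 12 (.branch 10 (.branch 9 (.leaf (x 8)) (.leaf (x 9))) (.branch 11 (.leaf (x 10)) (.leaf (x 11))))
      (.branch 16 (.branch 14 (.branch 13 (.leaf (x 12)) (.leaf (x 13))) (.branch 15 (.leaf (x 14)) (.leaf (x 15))))
        (.branch 18 (.branch 17 (.leaf (x 16)) (.leaf (x 17))) (.leaf (x 18)))))

variable (x : ℕ → ℝ)

/-- The context returns the variables. [this work] -/
theorem ctx19_get {i : ℕ} (hi : i < 19) : (ctx19 x).get i = x i := by
  interval_cases i <;> rfl

/-- `denote` of a variable below 19. [this work] -/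
theorem denote_var19 {i : ℕ} (hi : i < 19) : (Expr.var i).denote (ctx19 x) = x i := by
  change (ctx19 x).get i = x i
  exact ctx19_get x hi

/-! ### Masks, the cubic, `c_q` -/

/-- The loop of `maskE` in the 19-variable context. [this work] -/
theorem denote_maskE_go19 (m : ℕ) : ∀ (fuel i : ℕ) (acc : Expr), i + fuel ≤ 15 →
    (maskE.go m i fuel acc).denote (ctx19 x) = acc.denote (ctx19 x) + ∑ j ∈ Finset.Ico i (i + fuel), if m.testBit j then x j else 0 := by
  intro fuel
  induction fuel with
  | zero => intro i acc _; simp [maskE.go]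
  | succ f ih =>
    intro i acc h
    have hi : i < 19 := by omega
    have e1 : i + 1 + f = i + (f + 1) := by omega
    rw [maskE.go, Finset.sum_eq_sum_Ico_succ_bot (show i < i + (f + 1) by omega), ih (i + 1) _ (by omega), e1]
    split_ifs with hb
    · rw [denote_add, denote_var19 x hi]; ring
    · ring

/-- `maskE m` denotes `msum m x` (only the cell variables `0..14` occur). [this work] -/
theorem denote_maskE19 (m : ℕ) : (maskE m).denote (ctx19 x) = msum m x := by
  rw [maskE, denote_maskE_go19 x m 15 0 (.natCast 0) (by omega), denote_natCast, msum, Nat.cast_zero, zero_add, Nat.zero_add,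
    Finset.range_eq_Ico]

/-- `e3E` denotes `e3val`. [this work] -/
theorem denote_e3E19 (A B C : ℕ) : (e3E A B C).denote (ctx19 x) = e3val A B C x := by
  simp only [e3E, e3val, sigmaE, denote_add, denote_sub, denote_mul, denote_natCast, denote_maskE19, Nat.cast_ofNat]

/-- The value of `c_q = qW(q0+qX+qY+qW) − (qX+qW)(qY+qW)`. [this work] -/
noncomputable def cqVal (x : ℕ → ℝ) : ℝ := x 18 * (x 15 + x 16 + x 17 + x 18) - (x 16 + x 18) * (x 17 + x 18)

/-- `cqE` denotes `cqVal`. [this work] -/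
theorem denote_cqE : cqE.denote (ctx19 x) = cqVal x := by
  simp only [cqE, cqVal, denote_sub, denote_mul, denote_add, denote_var19 x (show 15 < 19 by norm_num),
    denote_var19 x (show 16 < 19 by norm_num), denote_var19 x (show 17 < 19 by norm_num), denote_var19 x (show 18 < 19 by norm_num)]

/-! ### Rows -/

/-- The value of a row on a valuation. [this work] -/
noncomputable def frowVal : FRow → (ℕ → ℝ) → ℝ
  | .one, _ => 1
  | .onecq, x => cqVal x
  | .prod P Q R S, x => msum P x * msum Q x - msum R x * msum S x
  | .prodcq P Q R S, x => (msum P x * msum Q x - msum R x * msum S x) * cqVal x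
  | .e3 A B C, x => e3val A B C x

/-- `frowE r` denotes `frowVal r x`. [this work] -/
theorem denote_frowE (r : FRow) : (frowE r).denote (ctx19 x) = frowVal r x := by
  cases r with
  | one => rw [frowE, denote_natCast, frowVal, Nat.cast_one]
  | onecq => rw [frowE, denote_cqE, frowVal]
  | prod P Q R S => simp only [frowE, frowVal, denote_sub, denote_mul, denote_maskE19]
  | prodcq P Q R S => simp only [frowE, frowVal, denote_sub, denote_mul, denote_maskE19, denote_cqE]
  | e3 A B C => rw [frowE, denote_e3E19, frowVal]

/-! ### Monomials, blocks, the certificate -/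

/-- `monoE l` denotes `monoVal l x` (indices below 19). [this work] -/
theorem denote_monoE19 : ∀ l : List ℕ, (∀ i ∈ l, i < 19) → (monoE l).denote (ctx19 x) = monoVal l x
  | [], _ => by rw [monoE, denote_natCast, monoVal, List.map_nil, List.prod_nil, Nat.cast_one]
  | i :: l, h => by
    rw [monoE, denote_mul, denote_var19 x (h i (by simp)), denote_monoE19 l (fun k hk => h k (List.mem_cons_of_mem i hk)), monoVal,
      monoVal, List.map_cons, List.prod_cons]

/-- Well-formedness of a block: variable indices below 19 in every multiplier. [this work] -/
def FBlock.wf (b : FBlock) : Bool := b.mult.all fun t => t.2.all fun i => decide (i < 19)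

/-- The value of the whole certificate: `Σ_blocks Σ_terms c · mono · row`. [this work] -/
noncomputable def fcertVal (bs : List FBlock) (x : ℕ → ℝ) : ℝ :=
  (bs.map fun b => ((b.mult.map fun t => (t.1 : ℝ) * monoVal t.2 x * frowVal b.row x)).sum).sum

/-- `fcertE bs` denotes `fcertVal bs x` for well-formed blocks. [this work] -/
theorem denote_fcertE (bs : List FBlock) (hwf : ∀ b ∈ bs, b.wf = true) : (fcertE bs).denote (ctx19 x) = fcertVal bs x := by
  rw [fcertE, denote_sumBal]
  induction bs with
  | nil => simp [fcertTermsE, fcertVal]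
  | cons b bs ih =>
    have hb := hwf b (by simp)
    simp only [FBlock.wf, List.all_eq_true, decide_eq_true_eq] at hb
    have e1 : ((fblockTermsE b).map fun e => e.denote (ctx19 x)).sum =
        (b.mult.map fun t => (t.1 : ℝ) * monoVal t.2 x * frowVal b.row x).sum := by
      rw [fblockTermsE, List.map_map]
      congr 1
      refine List.map_congr_left fun t ht => ?_
      rw [Function.comp_apply, denote_mul, denote_mul, denote_natCast, denote_monoE19 x t.2 (hb t ht), denote_frowE]
    rw [fcertTermsE, List.map_append, List.sum_append, e1, ih (fun b' hb' => hwf b' (List.mem_cons_of_mem b hb'))]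
    simp [fcertVal]

/-- **Nonnegativity of the certificate value**: nonnegative variables, nonnegative rows. [this work] -/
theorem fcertVal_nonneg (bs : List FBlock) (hx : ∀ i, 0 ≤ x i) (hrows : ∀ b ∈ bs, 0 ≤ frowVal b.row x) : 0 ≤ fcertVal bs x := by
  unfold fcertVal
  refine List.sum_nonneg ?_
  intro v hv
  obtain ⟨b, hb, rfl⟩ := List.mem_map.1 hv
  refine List.sum_nonneg ?_
  intro u hu
  obtain ⟨t, -, rfl⟩ := List.mem_map.1 hu
  exact mul_nonneg (mul_nonneg (Nat.cast_nonneg _) (monoVal_nonneg x hx _)) (hrows b hb)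

/-! ### The target -/

/-- `ftargetE pos neg` denotes `polyVal pos x − polyVal neg x` (indices below 19). [this work] -/
theorem denote_ftargetE (pos neg : List (ℕ × List ℕ)) (hpos : ∀ t ∈ pos, ∀ i ∈ t.2, i < 19) (hneg : ∀ t ∈ neg, ∀ i ∈ t.2, i < 19) :
    (ftargetE pos neg).denote (ctx19 x) = polyVal pos x - polyVal neg x := by
  have h : ∀ l : List (ℕ × List ℕ), (∀ t ∈ l, ∀ i ∈ t.2, i < 19) →
      (sumBal 20 (l.map fun t => Expr.mul (.natCast t.1) (monoE t.2))).denote (ctx19 x) = polyVal l x := by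
    intro l hl
    rw [denote_sumBal, polyVal, List.map_map]
    congr 1
    refine List.map_congr_left fun t ht => ?_
    rw [Function.comp_apply, denote_mul, denote_natCast, denote_monoE19 x _ (hl t ht)]
  rw [ftargetE, denote_sub, h pos hpos, h neg hneg]

/-- Well-formedness of a monomial list: indices below 19. [this work] -/
def monosWf (l : List (ℕ × List ℕ)) : Bool := l.all fun t => t.2.all fun i => decide (i < 19)

/-- `monosWf` unpacked. [this work] -/
theorem monosWf_spec {l : List (ℕ × List ℕ)} (h : monosWf l = true) : ∀ t ∈ l, ∀ i ∈ t.2, i < 19 := by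
  intro t ht i hi
  simp only [monosWf, List.all_eq_true, decide_eq_true_eq] at h
  exact h t ht i hi

/-- **Transport of the checked identity to `ℝ`**: if `fcheckN pos neg bs` holds (and the data are well formed), then
`polyVal pos x − polyVal neg x = fcertVal bs x` for every real valuation. [this work] -/
theorem ftarget_eq_fcert {pos neg : List (ℕ × List ℕ)} {bs : List FBlock} (hcheck : fcheckN pos neg bs = true)
    (hpos : monosWf pos = true) (hneg : monosWf neg = true) (hwf : ∀ b ∈ bs, b.wf = true) :
    polyVal pos x - polyVal neg x = fcertVal bs x := by
  have h := denote_eq_of_fcheckN (ctx19 x) hcheck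
  rw [denote_ftargetE x pos neg (monosWf_spec hpos) (monosWf_spec hneg), denote_fcertE x bs hwf] at h
  exact h

/-! ### The valuation -/

/-- The 19-variable valuation: far cells `f 0..14`, then `q0, qX, qY, qW`. [this work] -/
noncomputable def val19 (f : ℕ → ℝ) (q0 qX qY qW : ℝ) : ℕ → ℝ := fun i =>
  if i < 15 then f i else if i = 15 then q0 else if i = 16 then qX else if i = 17 then qY else qW

/-- Mask sums only see the far cells. [this work] -/
theorem msum_val19 (f : ℕ → ℝ) (q0 qX qY qW : ℝ) (T : ℕ) : msum T (val19 f q0 qX qY qW) = msum T f := by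
  unfold msum
  refine Finset.sum_congr rfl fun i hi => ?_
  rw [Finset.mem_range] at hi
  simp only [val19, if_pos hi]

/-- The cubic only sees the far cells. [this work] -/
theorem e3val_val19 (f : ℕ → ℝ) (q0 qX qY qW : ℝ) (A B C : ℕ) : e3val A B C (val19 f q0 qX qY qW) = e3val A B C f := by
  simp only [e3val, msum_val19]

/-- The value of `c_q`. [this work] -/
theorem cqVal_val19 (f : ℕ → ℝ) (q0 qX qY qW : ℝ) : cqVal (val19 f q0 qX qY qW) = qW * (q0 + qX + qY + qW) - (qX + qW) * (qY + qW) := by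
  simp only [cqVal, val19]; norm_num

/-- The near class variables of the valuation. [this work] -/
theorem val19_q (f : ℕ → ℝ) (q0 qX qY qW : ℝ) :
    val19 f q0 qX qY qW 15 = q0 ∧ val19 f q0 qX qY qW 16 = qX ∧ val19 f q0 qX qY qW 17 = qY ∧ val19 f q0 qX qY qW 18 = qW := by
  simp [val19]

/-- The valuation is nonnegative when all its inputs are. [this work] -/
theorem val19_nonneg {f : ℕ → ℝ} {q0 qX qY qW : ℝ} (hf : ∀ i, 0 ≤ f i) (h0 : 0 ≤ q0) (hX : 0 ≤ qX) (hY : 0 ≤ qY) (hW : 0 ≤ qW) (i : ℕ) :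
    0 ≤ val19 f q0 qX qY qW i := by
  unfold val19; split_ifs <;> first | exact hf i | assumption

/-! ### Mask arithmetic -/

/-- Intersecting with `full` does not change a mask sum. [this work] -/
theorem msum_full_and (f : ℕ → ℝ) (T : ℕ) : msum (full &&& T) f = msum T f := by
  unfold msum
  refine Finset.sum_congr rfl fun i hi => ?_
  rw [Finset.mem_range] at hi
  have hf : full.testBit i = true := by rw [full, Nat.testBit_two_pow_sub_one]; exact decide_eq_true hi
  simp [Nat.testBit_and, hf]

end IncStarTwoCut.FXCert

end Summit.CriticalPhenomena.PercolationContinuityZ3.Theorems
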